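import Summits.BirchSwinnertonDyer.BirchSwinnertonDyer.Theorems.KatoDescentPotSupersingularASideLedger
import Summits.BirchSwinnertonDyer.BirchSwinnertonDyer.Theorems.KatoDescentPotSupersingularKatoFiniteLevelStrictTamagawaProductBound
import Literature.NumberTheory.EllipticCurves.LeadingTermPPartProofs
import HarnessLib

/-!
# The A⊕S ledger of crux M at the zeta line in CLASSICAL INVARIANTS (rank `0`): for `k ≫ 0`,
# `p^{v_p(Tam W)} · #Ш(W)[p^∞] · [B_k(ℤ_p y₀) : B_k(ℤ_p y₀) ⊓ 𝓚_k^⊥] · [A : ℤ_p y₀] ≤ p^{v_p(c_p)} · #Sel_str^{ur}(W[p^∞]) · p^k · #W(ℚ)[p^k] · #W(ℚ)[p^N]`,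
# with `#W(ℚ)[p^k] · #W(ℚ)[p^N] ∣ (#W(ℚ)_tors)²`
# (route `KatoDescentPotSupersingular` / `…Tame…`, crux M = stmt-BirchSwinnertonDyer-19196; route-free helper)

Seat `bsd-potss-rkm` g20 (prover; cell `bsd-potss`), item stmt-BirchSwinnertonDyer-19196 (`--supports … --as helper`; closes nothing).
HONEST FRAMING: BSD is not proved by any of this; nothing is booked; theorems only (no definition, no named fact).

## What

Part 49 (`exists_forall_aSide_le`) reads `#Sel_{p^∞} · ∏_{ℓ∈T∖{p}} #H¹_ur(ℚ_ℓ,W[p^∞]) · r_k(ℤ_p y₀) · [A : ℤ_p y₀] ≤ #Sel_str^{ur} · p^k · [W(ℚ):p^kW(ℚ)] · #W(ℚ)[p^N]`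
(`r_k(Y) = [B_k(Y) : B_k(Y) ⊓ 𝓚_k^⊥]`).  In rank `0` (`W(ℚ)` finite) every factor is a classical invariant:

* `index_range_zsmul_eq_natCard_torsionBy` — `[G : nG] = #G[n]` for a finite abelian group `G` (`W(ℚ)` in rank `0`);
* `natCard_torsionBy_point_dvd_torsionOrder` — `#W(ℚ)[n] ∣ #W(ℚ)_tors` (`n ≠ 0`), so `#W(ℚ)[p^k] · #W(ℚ)[p^N] ∣ (#W(ℚ)_tors)²`;
* `Sel_{p^∞} = Ш[p^∞]` in rank `0` is the tree's `natCard_selmerGroupPInfty_eq_natCard_primaryComponent_sha`, and the Néron/Tamagawa reading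
  `p^{v_p(Tam W)} ≤ p^{v_p(c_p)} · ∏_{ℓ∈T∖{p}} #H¹_ur(ℚ_ℓ,W[p^∞])` is part 28 (`pow_padicValNat_tamagawaProduct_le_rat`);
* **`exists_forall_aSide_le_classical`** — the displayed inequality, for every Poitou–Tate family / Weil datum at the two auxiliary levels and
  under the displayed zeta-line saturation `hY` (brick (b), NOT proved here), exactly as in part 49.

READING.  With brick (b) in counting form `r_k(ℤ_p y₀) = p^{k−e}`, `e = a + v_p(λ(0)) + t_p − v_p(c_p)` (Kato Lemma 14.18 + the value of the dual
exponential, `a = ord_p(L(W,1)/Ω)`), and `#W(ℚ)[p^k]·#W(ℚ)[p^N] ∣ (#W(ℚ)_tors)²`, the inequality says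
`ord_p #Ш + v_p(Tam) + ord_p [A : ℤ_p y₀] ≤ a + v_p(λ(0)) + (ord_p #Sel_str^{ur} + t_p) + 2·ord_p #W(ℚ)_tors`
`≤ a + v_p(λ(0)) + (ord_p #Sel_str^{ur} + t_p − t₀) + 3·ord_p #W(ℚ)_tors` (`t₀ = ord_p #W(ℚ)[p^∞] ≤ ord_p #W(ℚ)_tors`) — the `count` clause of
the held package `Kato2004.MemberHullZetaInputs` (item 20297) with `ord_p #(𝐇²/X𝐇²)` in place of `ord_p #Sel_str^{ur}(W[p^∞]) + t_p − t₀`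
(`= ord_p #H²(ℤ[1/p], T_pW)`, Kato (14.14.2) + (14.9.3)).  So the `count` clause is kernel modulo (b′) and (c2′) only (module docstring of part 49).

References: K. Kato, Astérisque 295 (2004), §14.8, (14.9.3), Prop. 14.16 and its proof (pp. 238–245), Lemma 14.18 (pp. 247–248) [Kato2004Asterisque];
R. Greenberg, LNM 1716 (1999), §1 p. 54, §4 p. 103 [GreenbergLNM1716]; J. H. Silverman, *AEC* (2009), VII.3, VIII.6 [SilvermanAEC2009].
-/

-- the summit and its single problem are both named `BirchSwinnertonDyer` (registry layout D-0017)
set_option linter.dupNamespace false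
set_option autoImplicit false

noncomputable section

open scoped Classical ContRepresentation NumberField AddSubgroup
open CategoryTheory Function Field NumberField IsDedekindDomain WeierstrassCurve
open Literature.NumberTheory.EllipticCurves Literature.NumberTheory.GaloisRepresentations
  Literature.NumberTheory.GaloisRepresentations.DiscreteGaloisModule Literature.NumberTheory.GaloisCohomology
open Literature.NumberTheory.EllipticCurves.Kato2004 Literature.NumberTheory.EllipticCurves.Kato2004.EulerSystemValues
open Summit.BirchSwinnertonDyer.Rank1Residual.X11b.Levels Summit.BirchSwinnertonDyer.Rank1Residual.X11b.LocBridge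
  Summit.BirchSwinnertonDyer.Rank1Residual.X11b.LevelKummer Summit.BirchSwinnertonDyer.Rank1Residual.X11b.FiniteDuality
  Summit.BirchSwinnertonDyer.Rank1Residual.X11b.AcSelmer
open Summit.BirchSwinnertonDyer.Rank1Residual.GaloisImage
open Summit.BirchSwinnertonDyer.BirchSwinnertonDyer.Theorems.KummerTowerOrthogonal

namespace Summit.BirchSwinnertonDyer.BirchSwinnertonDyer.Theorems.KatoFiniteLevelCount

/-! ## §1 Two readings of a finite Mordell–Weil group -/

section Readings

variable {G : Type*} [AddCommGroup G]

/-- **`[G : nG] = #G[n]`** for a finite abelian group `G`: multiplication by `n` has kernel `G[n]` and image `nG`, and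
`#G = #G[n] · #nG = #nG · [G : nG]`. [cite: SilvermanAEC2009, VIII.§1 (the Kummer sequence for a finite group)] -/
theorem index_range_zsmul_eq_natCard_torsionBy [Finite G] (n : ℤ) :
    (zsmulAddGroupHom n : G →+ G).range.index = Nat.card ↥(G[n]) := by
  set f : G →+ G := zsmulAddGroupHom n with hf
  have hker : f.ker = G[n] := by
    ext x
    rw [AddMonoidHom.mem_ker, hf, zsmulAddGroupHom_apply]
    exact (Submodule.mem_torsionBy_iff (R := ℤ) n x).symm
  have h1 : f.ker.index = Nat.card f.range := AddSubgroup.index_ker f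
  have h2 : Nat.card f.range * f.range.index = Nat.card G := AddSubgroup.card_mul_index f.range
  have h3 : Nat.card f.ker * f.ker.index = Nat.card G := AddSubgroup.card_mul_index f.ker
  rw [← hker]
  have hpos : 0 < Nat.card f.range := Nat.card_pos
  rw [h1] at h3
  rw [← h2, mul_comm] at h3
  exact Nat.eq_of_mul_eq_mul_left hpos h3.symm

/-- **`#W(K)[n] ∣ #W(K)_tors`** for `n ≠ 0` when `W(K)` is finite (rank `0`): `W(K)[n]` is a subgroup of the torsion subgroup.
[cite: SilvermanAEC2009, VII.3 and VIII.6 (the torsion subgroup)] -/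
theorem natCard_torsionBy_point_dvd_torsionOrder {K : Type*} [Field K] (W : WeierstrassCurve K) [Finite W.toAffine.Point]
    (n : ℤ) (hn : n ≠ 0) : Nat.card ↥(W.toAffine.Point[n]) ∣ W.torsionOrder := by
  unfold WeierstrassCurve.torsionOrder
  refine AddSubgroup.card_dvd_of_le fun x hx => ?_
  rw [AddCommGroup.mem_torsion, isOfFinAddOrder_iff_zsmul_eq_zero]
  exact ⟨n, hn, (Submodule.mem_torsionBy_iff (R := ℤ) n x).mp hx⟩

/-- `#W(K)[m] · #W(K)[n] ∣ (#W(K)_tors)²` (`m, n ≠ 0`, `W(K)` finite) — the torsion slack of crux M's ledger is at most `2·ord_p #W(ℚ)_tors` here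
(`3·ord_p` in the `count` clause of `MemberHullZetaInputs`, the third copy absorbing `t₀` of `#H²(ℤ[1/p],T_pW) = #Sel_str^{ur}·p^{t_p−t₀}`).
[cite: Kato2004Asterisque, Prop. 14.16 (2) (p. 244)] [cite: SilvermanAEC2009, VII.3 and VIII.6] -/
theorem natCard_torsionBy_mul_dvd_torsionOrder_sq {K : Type*} [Field K] (W : WeierstrassCurve K) [Finite W.toAffine.Point]
    (m n : ℤ) (hm : m ≠ 0) (hn : n ≠ 0) :
    Nat.card ↥(W.toAffine.Point[m]) * Nat.card ↥(W.toAffine.Point[n]) ∣ W.torsionOrder ^ 2 := by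
  rw [sq]
  exact mul_dvd_mul (natCard_torsionBy_point_dvd_torsionOrder W m hm) (natCard_torsionBy_point_dvd_torsionOrder W n hn)

/-- The arithmetic of §2: `a ≤ c·Π`, `S·Π·r·i ≤ R` give `a·S·r·i ≤ c·R`. [folklore] -/
theorem mul_tamagawa_le {a c P S r i R : ℕ} (ha : a ≤ c * P) (h : S * P * r * i ≤ R) : a * S * r * i ≤ c * R :=
  calc a * S * r * i ≤ c * P * S * r * i := by gcongr
    _ = c * (S * P * r * i) := by ring
    _ ≤ c * R := Nat.mul_le_mul_left _ h

end Readings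

/-! ## §2 The A⊕S ledger in classical invariants -/

section Classical

variable (W : WeierstrassCurve ℚ) [W.IsElliptic] (p : ℕ) [Fact p.Prime] [ContinuousSMul ℤ_[p] (W.tateModule p)]
  (𝓤inf 𝓢inf : SelmerStructure (primaryGaloisModule W p))

/-- **THE A⊕S LEDGER OF CRUX M IN CLASSICAL INVARIANTS (rank `0`)**: `W(ℚ)` finite, `Ш(W)[p^∞]` finite, `p` odd, `T ∋ v_p` off which `W` is good,
Kato's structures `𝓤∞`/`𝓢∞`, `y₀ ∈ A = H¹(ℤ[1/p],T_pW)` with `p^N A ⊆ ℤ_p y₀`; then `∃ j s k₀, ∀ k ≥ k₀`, for every Poitou–Tate family / Weil datum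
at the two auxiliary levels and under the displayed zeta-line saturation `hY` (brick (b), not proved here):
`p^{v_p(Tam W)} · #Ш(W)[p^∞] · [B_k(ℤ_p y₀) : B_k(ℤ_p y₀) ⊓ 𝓚_k^⊥] · [A : ℤ_p y₀] ≤ p^{v_p(c_p)} · (#Sel_str^{ur} · p^k · #W(ℚ)[p^k] · #W(ℚ)[p^N])`
— part 49 × `Sel_{p^∞} = Ш[p^∞]` × `[W(ℚ):p^kW(ℚ)] = #W(ℚ)[p^k]` × part 28.  See the module docstring for the reading as the `count` clause of
`MemberHullZetaInputs` modulo (b′), (c2′).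
[cite: Kato2004Asterisque, §14.8 (p. 238), (14.9.3) (p. 240), Prop. 14.16 and its proof (pp. 244–245), Lemma 14.18 (pp. 247–248)]
[cite: GreenbergLNM1716, §1 p. 54 and §4 p. 103] -/
theorem exists_forall_aSide_le_classical (hodd : p ≠ 2) (T : Finset (HeightOneSpectrum (𝓞 ℚ)))
    (hpT : primePlace p ∈ T) (hT : ∀ v : HeightOneSpectrum (𝓞 ℚ), v ∉ T → W.HasGoodReductionAt v)
    [Finite W.toAffine.Point] [Finite (AddCommGroup.primaryComponent (↥W.sha) p)]
    (hUp : 𝓤inf (Sum.inr (primePlace p)) = ⊤)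
    (hUur : ∀ v : HeightOneSpectrum (𝓞 ℚ), v ≠ primePlace p →
      𝓤inf (Sum.inr v) = unramifiedSubgroup (GaloisRep.toLocal v (primaryGaloisModule W p)) 1)
    (hUinl : ∀ w : InfinitePlace ℚ, 𝓤inf (Sum.inl w) = ⊤)
    (hSp : 𝓢inf (Sum.inr (primePlace p)) = ⊥)
    (hSur : ∀ v : HeightOneSpectrum (𝓞 ℚ), v ≠ primePlace p →
      𝓢inf (Sum.inr v) = unramifiedSubgroup (GaloisRep.toLocal v (primaryGaloisModule W p)) 1)
    (hSinl : ∀ w : InfinitePlace ℚ, 𝓢inf (Sum.inl w) = ⊤)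
    (y₀ : H1 (tateRep W p) ⊤) (hy₀ : y₀ ∈ integralH1 (tateRep W p) p ⊤) (N : ℕ)
    (hN : ∀ a ∈ integralH1 (tateRep W p) p ⊤, ((p ^ N : ℕ) : ℤ) • a ∈ (ℤ_[p] ∙ y₀).toAddSubgroup) :
    ∃ j s k₀ : ℕ, ∀ k : ℕ, k₀ ≤ k →
      haveI := neZero_pow p j; haveI := neZero_pow p s; haveI := neZero_pow p k
      haveI : Finite (geomTorsion W ((p ^ k : ℕ) : ℤ)) := finite_geomTorsion_pow W p k
      haveI : Finite (geomTorsion W ((p ^ s * p ^ k : ℕ) : ℤ)) :=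
        W.finite_torsionPoints_holds (AlgebraicClosure ℚ) (Int.natCast_ne_zero.mpr (NeZero.ne (p ^ s * p ^ k)))
      ∀ (inv : LocalInvariants ℚ (p ^ j * p ^ k)), inv.SumLocalTermEqZero → inv.IsPerfect →
      ∀ (ε : geomTorsion W ((p ^ j * p ^ k : ℕ) : ℤ) → geomTorsion W ((p ^ j * p ^ k : ℕ) : ℤ) → AlgebraicClosure ℚ)
        (hμ : ∀ S T, ε S T ^ (p ^ j * p ^ k) = 1)
        (hadd₁ : ∀ S₁ S₂ T, ε (S₁ + S₂) T = ε S₁ T * ε S₂ T)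
        (hadd₂ : ∀ S T₁ T₂, ε S (T₁ + T₂) = ε S T₁ * ε S T₂)
        (hgal : ∀ (σ : absoluteGaloisGroup ℚ) (S T : geomTorsion W ((p ^ j * p ^ k : ℕ) : ℤ)), σ • ε S T = ε (σ • S) (σ • T)),
      (∀ y ∈ (ℤ_[p] ∙ y₀).toAddSubgroup,
        ((galoisCohomology.localization ((W.torsionGaloisModule ((p ^ k : ℕ) : ℤ)).tateDual (p ^ j * p ^ k))
              (Sum.inr (primePlace p)) 1).comp
            ((galoisCohomology.map (DiscreteGaloisModule.pairingDualIntertwining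
                (ρ₁ := W.torsionGaloisModule ((p ^ k : ℕ) : ℤ)) (ρ₂ := W.torsionGaloisModule ((p ^ k : ℕ) : ℤ))
                (B := descendHom W (p ^ j) (p ^ k) ε hμ hadd₁ hadd₂)
                (descendHom_smul W (p ^ j) (p ^ k) ε hμ hadd₁ hadd₂ hgal)) 1).comp
              (((galoisCohomology.map (W.torsionInclusion (intPow_dvd_natCast_pow p k)) 1).comp
                  (ofTopSubgroup (W.torsionGaloisModule ((p : ℤ) ^ k)).toTopRep 1).hom.toLinearMap.toAddMonoidHom).comp
                (reduceH1Pk W p k ⊤)))) y ∈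
          annRight (localTatePairingZMod (W.torsionGaloisModule ((p ^ k : ℕ) : ℤ)) (p ^ j * p ^ k)
            (Sum.inr (primePlace p)) (inv (Sum.inr (primePlace p))))
            (W.kummerSelmerStructure ((p ^ k : ℕ) : ℤ) (Sum.inr (primePlace p))) →
        ∃ y' ∈ (ℤ_[p] ∙ y₀).toAddSubgroup, ((p ^ N : ℕ) : ℤ) • y' = y) →
      ∀ (e : geomTorsion W ((p ^ s * p ^ k : ℕ) : ℤ) → geomTorsion W ((p ^ s * p ^ k : ℕ) : ℤ) → AlgebraicClosure ℚ)
        (hμ' : ∀ S T, e S T ^ (p ^ s * p ^ k) = 1)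
        (hadd₁' : ∀ S₁ S₂ T, e (S₁ + S₂) T = e S₁ T * e S₂ T)
        (hadd₂' : ∀ S T₁ T₂, e S (T₁ + T₂) = e S T₁ * e S T₂)
        (hgal' : ∀ (σ : absoluteGaloisGroup ℚ) (S T : geomTorsion W ((p ^ s * p ^ k : ℕ) : ℤ)), σ • e S T = e (σ • S) (σ • T)),
        (∀ P, e P P = 1) → (∀ P, (∀ Q, e Q P = 1) → P = 0) →
      ∀ (inv' : LocalInvariants ℚ (p ^ s * p ^ k)), inv'.IsPerfect → inv'.SelmerComplement →
      p ^ padicValNat p W.tamagawaProduct * Nat.card (AddCommGroup.primaryComponent (↥W.sha) p) *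
            ((((ℤ_[p] ∙ y₀).toAddSubgroup.map
                  (((galoisCohomology.map (W.torsionInclusion (intPow_dvd_natCast_pow p k)) 1).comp
                      (ofTopSubgroup (W.torsionGaloisModule ((p : ℤ) ^ k)).toTopRep 1).hom.toLinearMap.toAddMonoidHom).comp
                    (reduceH1Pk W p k ⊤))).map
                  (galoisCohomology.map (DiscreteGaloisModule.pairingDualIntertwining
                    (ρ₁ := W.torsionGaloisModule ((p ^ k : ℕ) : ℤ)) (ρ₂ := W.torsionGaloisModule ((p ^ k : ℕ) : ℤ))
                    (B := descendHom W (p ^ j) (p ^ k) ε hμ hadd₁ hadd₂)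
                    (descendHom_smul W (p ^ j) (p ^ k) ε hμ hadd₁ hadd₂ hgal)) 1)).map
                (galoisCohomology.localization ((W.torsionGaloisModule ((p ^ k : ℕ) : ℤ)).tateDual (p ^ j * p ^ k))
                  (Sum.inr (primePlace p)) 1) ⊓
              annRight (localTatePairingZMod (W.torsionGaloisModule ((p ^ k : ℕ) : ℤ)) (p ^ j * p ^ k)
                (Sum.inr (primePlace p)) (inv (Sum.inr (primePlace p))))
                (W.kummerSelmerStructure ((p ^ k : ℕ) : ℤ) (Sum.inr (primePlace p)))).relIndex
              ((((ℤ_[p] ∙ y₀).toAddSubgroup.map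
                  (((galoisCohomology.map (W.torsionInclusion (intPow_dvd_natCast_pow p k)) 1).comp
                      (ofTopSubgroup (W.torsionGaloisModule ((p : ℤ) ^ k)).toTopRep 1).hom.toLinearMap.toAddMonoidHom).comp
                    (reduceH1Pk W p k ⊤))).map
                  (galoisCohomology.map (DiscreteGaloisModule.pairingDualIntertwining
                    (ρ₁ := W.torsionGaloisModule ((p ^ k : ℕ) : ℤ)) (ρ₂ := W.torsionGaloisModule ((p ^ k : ℕ) : ℤ))
                    (B := descendHom W (p ^ j) (p ^ k) ε hμ hadd₁ hadd₂)
                    (descendHom_smul W (p ^ j) (p ^ k) ε hμ hadd₁ hadd₂ hgal)) 1)).map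
                (galoisCohomology.localization ((W.torsionGaloisModule ((p ^ k : ℕ) : ℤ)).tateDual (p ^ j * p ^ k))
                  (Sum.inr (primePlace p)) 1)) *
            ((ℤ_[p] ∙ y₀).toAddSubgroup.relIndex (integralH1 (tateRep W p) p ⊤).toAddSubgroup) ≤
        p ^ padicValNat p ((W.baseChange ((primePlace p).adicCompletion ℚ)).localTamagawaNumber
            ((primePlace p).adicCompletionIntegers ℚ)) *
          (Nat.card 𝓢inf.selmerGroup * p ^ k * Nat.card ↥(W.toAffine.Point[((p ^ k : ℕ) : ℤ)]) *
            Nat.card ↥(W.toAffine.Point[((p ^ N : ℕ) : ℤ)])) := by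
  haveI : Finite (W.selmerGroupPInfty p) := Nat.finite_of_card_ne_zero (by
    rw [W.natCard_selmerGroupPInfty_eq_natCard_primaryComponent_sha p]; exact Nat.card_pos.ne')
  obtain ⟨j, s, k₀, hA⟩ := exists_forall_aSide_le W p 𝓤inf 𝓢inf hodd T hpT hT hUp hUur hUinl hSp hSur hSinl y₀ hy₀ N hN
  refine ⟨j, s, k₀, fun k hk => ?_⟩
  intro inv hsum hperf ε hμ hadd₁ hadd₂ hgal hY e hμ' hadd₁' hadd₂' hgal' halt hnondeg inv' hperf' hcompl'
  have h1 := hA k hk inv hsum hperf ε hμ hadd₁ hadd₂ hgal hY e hμ' hadd₁' hadd₂' hgal' halt hnondeg inv' hperf' hcompl'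
  rw [W.natCard_selmerGroupPInfty_eq_natCard_primaryComponent_sha p, index_range_zsmul_eq_natCard_torsionBy] at h1
  exact mul_tamagawa_le (pow_padicValNat_tamagawaProduct_le_rat W p T hpT hT) h1

end Classical

end Summit.BirchSwinnertonDyer.BirchSwinnertonDyer.Theorems.KatoFiniteLevelCount

end
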